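import Summits.BirchSwinnertonDyer.Rank1Residual.X11b.CastellaErratumCongruenceLimit
import Summits.BirchSwinnertonDyer.Rank1Residual.X11b.FittingOfNoFiniteSubmodule
import HarnessLib

/-!
# X11b, route R1 — erratum Thm. 1.1 ⇐ Thm. 2.3 with the inputs in their PRINTED form
# (Thm. 2.3: torsion + `Ch = (L_p)`; Lemma 2.2: no finite submodule; (b)+Lemma 2.1; (c); `L_p(f) ≠ 0`)

HONEST FRAMING (cell `b2b-bsdres`, run/shared/lean/b2b/bsd-rank1-residual/, verbatim in every
file): the goal of the cell is to DELETE the COMBINATION-SHAPED residual classes of the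
Birch–Swinnerton-Dyer formula for ALL analytic-rank `≤ 1` elliptic curves over `ℚ` — "full BSD
formula for every rank `≤ 1` curve in class `C`" assembled STRICTLY from published theorems — so
that the rank-`≤ 1` remainder becomes exactly the CONSTRUCTION-SHAPED classes, which are TYPED
(missing-input `Prop`s), NOT attempted. This is not "finishing BSD". Sub-cell
`b2b-bsdres-multr1-p1` (X11b via the re-proof of Castella 2018 Thm. A along the author's erratum):
a RESEARCH ROUTE; no claim beyond the stated class; X11b stays CONSTRUCTION-SHAPED; nothing here
changes a label. THEOREMS ONLY (no definition, no named fact, no `sorry`).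

`CastellaErratumCongruenceLimit.lean` kernel-checks the erratum's proof of its Thm. 1.1 from its
Thm. 2.3 (p. 4; "the argument in [Ski16, p. 192] applies verbatim") with the input for the
approximating forms `g_m` in the shape `Fitt_Λ(X^Σ_ac(A_{g_m})) = (L^Σ_p(g_m))`, which the erratum
derives in one sentence from Thm. 2.3 and Lemma 2.2 ("by Lemma 2.2 we know that `Ch = Fitt`").
`FittingOfNoFiniteSubmodule.lean` proves that sentence over the tree's `Λ = ℤ_p⟦T⟧`. This file
composes the two: **`iwasawaAlgebra_isTorsion_and_charIdeal_eq_of_congruences_printed`** — over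
`Λ = ℤ_p⟦T⟧` (`𝒪 = ℤ_p`, `I = (p)`), for a finite `Λ`-module `M` (`X^Σ_ac(E[p^∞])`), `L ≠ 0`
(`L^Σ_p(f)`: Cornut–Vatsal + [Cas20, Thm. 5.3]) and, for each `m ≥ 1`, a finite `Λ`-module `N_m`
(`X^Σ_ac(A_{g_m})`) and `L_m` (`L^Σ_p(g_m)`) with
  `e`   — `M/p^m M ≅ N_m/p^m N_m`                     [(b) `T_{g_m}/p^m ≃ T/p^m` + Lemma 2.1, dualised],
  `hT`  — `N_m` is `Λ`-torsion                          [Thm. 2.3 for `g_m`, first clause],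
  `hCh` — `char_Λ(N_m) = (L_m)`                         [Thm. 2.3 for `g_m`, second clause],
  `hnf` — `N_m` has no nonzero submodule of finite length [Lemma 2.2 for `g_m`],
  `hc`  — `(L_m) + (p^m) = (L) + (p^m)`                 [(c), [Cas20, Thm. 2.11]],
one has: `M` is `Λ`-torsion and `char_Λ(M) = Fitt_Λ(M) = (L)` — Thm. 1.1 for `Σ` ("`X^Σ_ac(E[p^∞])`
is `Λ`-torsion and `Ch_Λ(X^Σ_ac(E[p^∞]))Λ_{R₀} = (L^Σ_p(f))`"). EVERY step of erratum p. 4 that is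
commutative algebra is now a kernel theorem; what remains INPUT is arithmetic: Hida theory (a),(b),
Lemma 2.1 (Galois cohomology, uses (iv) `E(ℚ_p)[p] = 0`), [Cas20, Thm. 2.11] (c), Lemma 2.2 as a
statement about `Sel^Σ_𝔭(K_∞, A_{g_m})`, the nonvanishing of `L_p(f)`, and Thm. 2.3 itself
(⇐ [FW21, Thm. 4.41], PREPRINT — the one unrefereed atom of route R1). Ring bookkeeping as in
`CastellaErratumCongruenceLimit.lean` (`Λ_𝒪 = ℤ_p⟦T⟧` here; the erratum's `Λ_𝒪^{ur}` needs the
same algebra over `R₀⟦T⟧`, a Noetherian local UFD, for which `FittingOfNoFiniteSubmodule.lean`'s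
Weierstrass-division step would be run with `R₀` in place of `ℤ_p`). CONDITIONAL on nothing;
deletes nothing; X11b stays CONSTRUCTION-SHAPED.

References: F. Castella, Erratum, Lemmas 2.1, 2.2, Thm. 2.3, proof of Thm. 1.1 (p. 4)
[Castella2018Erratum]; C. Skinner, Pacific J. Math. 283 (2016), § 3.1 (p. 192) [Skinner2016PacificMC].
-/

noncomputable section

open Literature.RingTheory.FittingIdeal Literature.NumberTheory.EllipticCurves
  Literature.NumberTheory.EllipticCurves.Module

namespace Summit.BirchSwinnertonDyer.Rank1Residual.X11b.CongruenceLimit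

variable (p : ℕ) [Fact p.Prime]

/-- **Erratum Thm. 1.1 ⇐ Thm. 2.3, printed inputs, kernel form over `Λ = ℤ_p⟦T⟧`.** See the
module docstring for the dictionary. The hypothesis `hF` of
`iwasawaAlgebra_isTorsion_and_charIdeal_eq_of_congruences` (`Fitt_Λ(N_m) = (L_m)`) is DERIVED here
from `hT`, `hCh` (Thm. 2.3 for `g_m`) and `hnf` (Lemma 2.2) by
`fittingIdeal_zero_eq_span_of_charIdeal_eq_span_of_forall_length`.
[cite: Castella2018Erratum, proof of Thm. 1.1 (p. 4)] [cite: Skinner2016PacificMC, §3.1 (p. 192)] -/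
theorem iwasawaAlgebra_isTorsion_and_charIdeal_eq_of_congruences_printed
    {M : Type} [AddCommGroup M] [Module (IwasawaAlgebra p) M] [Module.Finite (IwasawaAlgebra p) M]
    (N : ℕ → Type) [∀ m, AddCommGroup (N m)] [∀ m, Module (IwasawaAlgebra p) (N m)]
    [∀ m, Module.Finite (IwasawaAlgebra p) (N m)]
    {L : IwasawaAlgebra p} (hL : L ≠ 0) (Lm : ℕ → IwasawaAlgebra p)
    (e : ∀ m : ℕ, 1 ≤ m →
      ((M ⧸ ((Ideal.span {(PowerSeries.C (p : ℤ_[p]) : IwasawaAlgebra p)}) ^ m •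
          (⊤ : Submodule (IwasawaAlgebra p) M))) ≃ₗ[IwasawaAlgebra p]
        (N m ⧸ ((Ideal.span {(PowerSeries.C (p : ℤ_[p]) : IwasawaAlgebra p)}) ^ m •
          (⊤ : Submodule (IwasawaAlgebra p) (N m))))))
    (hT : ∀ m : ℕ, 1 ≤ m → Module.IsTorsion (IwasawaAlgebra p) (N m))
    (hCh : ∀ m : ℕ, 1 ≤ m → charIdeal (IwasawaAlgebra p) (N m) = Ideal.span {Lm m})
    (hnf : ∀ m : ℕ, 1 ≤ m → ∀ N' : Submodule (IwasawaAlgebra p) (N m),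
      Module.length (IwasawaAlgebra p) N' ≠ ⊤ → N' = ⊥)
    (hc : ∀ m : ℕ, 1 ≤ m →
      Ideal.span {Lm m} ⊔ (Ideal.span {(PowerSeries.C (p : ℤ_[p]) : IwasawaAlgebra p)}) ^ m =
        Ideal.span {L} ⊔ (Ideal.span {(PowerSeries.C (p : ℤ_[p]) : IwasawaAlgebra p)}) ^ m) :
    Module.IsTorsion (IwasawaAlgebra p) M ∧
      Module.fittingIdeal (IwasawaAlgebra p) M 0 = Ideal.span {L} ∧
      charIdeal (IwasawaAlgebra p) M = Ideal.span {L} :=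
  iwasawaAlgebra_isTorsion_and_charIdeal_eq_of_congruences p N hL Lm e
    (fun m hm => fittingIdeal_zero_eq_span_of_charIdeal_eq_span_of_forall_length p (N m)
      (hT m hm) (hnf m hm) (hCh m hm))
    hc

end Summit.BirchSwinnertonDyer.Rank1Residual.X11b.CongruenceLimit

end
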